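import Summits.CriticalPhenomena.PercolationContinuityZ3.Theses.PercNonProliferation

/-!
# Triage probe r2-1 — crux `NonProliferation` (stmt-CriticalPhenomena-4444)

Typed record of the triager's structural finding on card `avoidance-cost-covering`:
its transfer target `CoveringDecay` (∃ M) is EQUIVALENT to uniform quantile-tightness of the
SHELL-restricted spanning count at aspect ratio 2 (`QuantileTightShell`), by
(⇐) shell submultiplicativity over the vertex-disjoint closed dyadic shells
`{a_j ≤ |v|∞ ≤ 2a_j}`, `a_j = 2^j (m+1) − 1` (crux NOTES memo B(i)/C), and
(⇒) the card's own sphere covering (first lemma `covering_reduction`) applied inside a shell.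
Statements only (sorries): the proofs are on paper in TRIAGE-r2-1.md §A; nothing here is proposed.
-/

noncomputable section

namespace Summit.CriticalPhenomena.PercolationContinuityZ3.Cruxes.NonProliferation.TriageR2K1

open MeasureTheory Filter Topology
open Literature.Probability.LatticeModels Literature.Probability.Percolation
open Summit.CriticalPhenomena.PercolationContinuityZ3.Theses.PercNonProliferation

/-- The critical bond measure on `ℤ³`. -/
abbrev μ : Measure (BondConfig (Site 3)) := bondPercolation (zdGraph 3) (criticalProbI 3)

/-- probe: the crux elaborates. -/
theorem probe : NonProliferation := by
  sorry

/-- Card `avoidance-cost-covering`: "≥ M+1 distinct clusters of ω|B(km) join B(m) to ∂⁻B(km)"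
(verbatim from the card; `multiCross M 2 n` is the complement of the crux's event). -/
def multiCross (M k m : ℕ) : Set (BondConfig (Site 3)) :=
  {ω | ∃ x : Fin (M + 1) → Site 3, (∀ i, x i ∈ box 3 m) ∧
    (∀ i, ∃ y ∈ innerBoundary (zdGraph 3) (box 3 (k * m)),
      ω ∈ openConnIn (↑(box 3 (k * m)) : Set (Site 3)) (x i) y) ∧
    ∀ i j, i ≠ j → ω ∉ openConnIn (↑(box 3 (k * m)) : Set (Site 3)) (x i) (x j)}

/-- The crux's complement event is `multiCross M 2 n`, definitionally. -/
theorem crux_iff : NonProliferation ↔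
    ∃ (M : ℕ) (c : ℝ), 0 < c ∧ ∃ᶠ n : ℕ in atTop, c ≤ μ.real (multiCross M 2 n)ᶜ := by
  rfl

/-- Card's transfer target C⁺ (verbatim). -/
def CoveringDecay : Prop :=
  ∃ (M : ℕ) (C δ : ℝ), 0 < δ ∧ ∀ k m : ℕ, 2 ≤ k → 1 ≤ m →
    μ.real (multiCross M k m) ≤ C * (k : ℝ) ^ (-(2 + δ))

/-- Card's residual (verbatim shape): each further distinct crosser costs `C k^{-ζ}`. -/
def AvoidanceCostRatio : Prop :=
  ∃ (ζ C : ℝ), 0 < ζ ∧ ∀ k m j : ℕ, 2 ≤ k → 1 ≤ m →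
    μ.real (multiCross (j + 1) k m) ≤ C * (k : ℝ) ^ (-ζ) * μ.real (multiCross j k m)

/-- The closed ratio-2 shell `{a ≤ |v|∞ ≤ 2a}` as a vertex set. -/
def shell (a : ℕ) : Set (Site 3) := (↑(box 3 (2 * a)) : Set (Site 3)) \ ↑(box 3 (a - 1))

/-- SHELL-restricted spanning count `N_shell(a,2a) ≥ M+1`: `M+1` points of the inner sphere
`∂⁻B(a)... ` (typed as points of `B(a)` inside the shell, i.e. of sup-norm exactly `a` for `a ≥ 1`),
each joined INSIDE THE SHELL to `∂⁻B(2a)`, pairwise not joined inside the shell.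
(`N_shell ≥ N_box`: box-distinct ⇒ shell-distinct, and every box crosser contains a shell crosser.) -/
def shellMultiCross (M a : ℕ) : Set (BondConfig (Site 3)) :=
  {ω | ∃ x : Fin (M + 1) → Site 3, (∀ i, x i ∈ box 3 a ∧ x i ∈ shell a) ∧
    (∀ i, ∃ y ∈ innerBoundary (zdGraph 3) (box 3 (2 * a)), ω ∈ openConnIn (shell a) (x i) y) ∧
    ∀ i j, i ≠ j → ω ∉ openConnIn (shell a) (x i) (x j)}

/-- Uniform quantile-tightness of the shell count at ratio 2 beyond the `3/4`-quantile:
`∃ M a₀, ∀ a ≥ a₀, P(N_shell(a,2a) ≥ M+1) < 1/4` — a natural strengthening of the crux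
(the route file's "1−ε tightness" family, shell form). -/
def QuantileTightShell : Prop :=
  ∃ (M a₀ : ℕ) (q : ℝ), q < 1 / 4 ∧ ∀ a : ℕ, a₀ ≤ a → μ.real (shellMultiCross M a) ≤ q

/-- (⇐) shell submultiplicativity: `M+1` box-distinct crossers of `A(m,km)` give `M+1`
shell-distinct internal crossers of every closed dyadic shell `{a_j ≤ |v| ≤ 2a_j} ⊆ B(km)`,
`a_j = 2^j(m+1) − 1`; the shells are vertex-disjoint hence independent, so
`P(multiCross M k m) ≤ q^{#shells} ≤ q^{log₂ k − c} = C k^{−log₂(1/q)}` with `log₂(1/q) > 2`.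
[on paper, TRIAGE-r2-1 §A] -/
theorem coveringDecay_of_quantileTightShell : QuantileTightShell → CoveringDecay := by
  sorry

/-- (⇒) the card's sphere covering run INSIDE the shell `{n ≤ |v| ≤ 2n}` (mid-sphere `|v| = ⌊3n/2⌋`,
translates `z + B(m')`, `z + B(k m') ⊆ shell`): `P(N_shell(n,2n) > T(k)·M) ≤ T(k) C k^{-(2+δ)}`,
`T(k) ≤ 6(2k+5)²`, which is `< 1/4` for `k = k₀(C,δ)`. [on paper, TRIAGE-r2-1 §A] -/
theorem quantileTightShell_of_coveringDecay : CoveringDecay → QuantileTightShell := by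
  sorry

/-- Reimer's inequality makes `AvoidanceCostRatio` a consequence of a uniform ONE-arm bound
`sup_m P(B(m) ↔ ∂⁻B(km) in B(km)) ≤ C k^{-ζ}` (witnesses: all edges at the first `j+1` clusters
vs the open path of the extra crosser) — and that one-arm bound already forces `θ(p_c) = 0`
(`θ ≤ P(B(m) ↔ ∂⁻B(km))`). Recorded as the typed shape of TRIAGE-r2-1 §A(iv). -/
def UniformOneArmDecay : Prop :=
  ∃ (ζ C : ℝ), 0 < ζ ∧ ∀ k m : ℕ, 2 ≤ k → 1 ≤ m → μ.real (multiCross 0 k m) ≤ C * (k : ℝ) ^ (-ζ)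

theorem avoidanceCostRatio_of_uniformOneArmDecay : UniformOneArmDecay → AvoidanceCostRatio := by
  sorry

end Summit.CriticalPhenomena.PercolationContinuityZ3.Cruxes.NonProliferation.TriageR2K1

end
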